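import Mathlib
import HarnessLib
import HarnessLib.Audit
import Summits.AtomisticToContinuum.Statement
import Literature.MathematicalPhysics.QuantumManyBody.PeriodicBoseGas
import Summits.AtomisticToContinuum.BoseEinsteinCondensation.Theorems.BECRieszReverseHolderGroundStateEnergyFinite
import Summits.AtomisticToContinuum.BoseEinsteinCondensation.Theorems.BECSectorPoincareTwoScaleScatteringLengthFinite
import HarnessLib.Audit.Status.Attr

/-!
Route: BECNudgeWalk

DORMANT since 2026-08-25T09:09:06Z (reconciler: no traction for 7.6 d (last activity item-evidence-added at 2026-08-17T19:09:23Z); parked, not closed — `ledger route dormant route-AtomisticToContinuum-BECNudgeWalk --off` to reactivate) — unstaffed, not closed; items shared with open routes are served there. `ledger route dormant <id> --off` reactivates.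

# Route BECNudgeWalk — an invisible flat-mode reward decides TL-BEC in the Dirichlet box — buy the
condensate at s = θρa from proved energy bounds, remove it along an integrable
√s-gap/normal-variance walk; no BC transfer

It suffices to show X = NudgedCondensation ∧ NudgeRemoval (card sub-lhy-nudge-regulator, in the
common form recommended by novelty
audits 6/14/29/36 with its sibling reward-walk-gmor-descent). Setting: the DIRICHLET box Λ_L of the
Statement itself, L = (N/ρ)^(1/3),
flat mode φ₀ = L^(-3/2)·1_Λ (`constantMode L`), n₀(Ψ) = ⟨φ₀, γ_Ψ φ₀⟩ (`occupation`), the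
U(1)-invariant nudged functional
F_s(Ψ) = ⟨Ψ,HΨ⟩ + s·(N − n₀(Ψ)) on Dirichlet trial states (a reward s per particle in φ₀; the card's
−(g/V)N₀² and the sibling's s·n̂₊
agree to leading order), R(s) = inf F_s, R(0) = E₀^D, a = scattering length. NudgedCondensation
(RUNG): for all τ, θ > 0, at small density
and for all large N, R(θρa) ≤ E₀^D + θρa·τ·N — a nudge of strength s = θρa per excited particle, s/μ
= θ/8π as small as we please, buys
thermodynamic-limit condensation (depletion ≤ τN of the nudged ground state) from the PROVED
Lieb–Yngvason Dirichlet lower bound and the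
in-tree Jastrow upper-bound state localised into the box. NudgeRemoval (WALK): for every τ there is
θ ≤ 1 such that R(θρa) ≤ E₀^D + θρaτN
forces R(s) ≤ E₀^D + 2τsN for all 0 < s ≤ θρa — removing the nudge raises the ground-state depletion
by at most τN, i.e. the condensate
susceptibility −R″ is integrable at s = 0⁺. The MECHANISM for NudgeRemoval is filed as the two
conditional Bogoliubov cruxes NudgeGap
(Ky-Fan gap ≥ c√(ρa·s) for condensed near-minimisers) and CondensateVariance (‖n̂₀Ψ‖² ≤ n₀(Ψ)² + CN)
plus the support WalkGlue
(−R″ ≤ 2Var/Δ, bootstrap in s at fixed N). With the Dirichlet phase rigidity GroundStateRigidity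
(shared stmt-AtomisticToContinuum-3298),
finiteness (stmt-0850, stmt-0851) and the free case a = 0 (FreeDirichletBEC), WalkToBEC turns X into
HasGroundStateBEC v ρ with c = 1/2 at
every small ρ — in the Dirichlet box of the conjunct, with no periodic detour and no
boundary-condition transfer (stmt-0827 is NOT used).
Lean: `(∀ v : ℝ → ENNReal,
Literature.MathematicalPhysics.QuantumManyBody.BoseGas.IsRepulsiveFiniteRange v → ∀ τ θ : ℝ, 0 < τ →
0 < θ → ∃ ρ₀ : ℝ, 0 < ρ₀ ∧ ∀ ρ : ℝ, 0 < ρ → ρ < ρ₀ → ∀ᶠ N : ℕ in Filter.atTop, let L : ℝ :=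
Literature.MathematicalPhysics.QuantumManyBody.BoseGas.sideLength ρ N; let s : ℝ := θ * ρ *
(Literature.MathematicalPhysics.QuantumManyBody.BoseGas.scatteringLength v).toReal; (⨅ Ψ :
Literature.MathematicalPhysics.QuantumManyBody.BoseGas.TrialState N L,
(Literature.MathematicalPhysics.QuantumManyBody.BoseGas.energy v Ψ + ENNReal.ofReal s * ((N :
ENNReal) - Literature.MathematicalPhysics.QuantumManyBody.BoseGas.occupation N
(Literature.MathematicalPhysics.QuantumManyBody.BoseGas.constantMode L) Ψ.ψ))) ≤
Literature.MathematicalPhysics.QuantumManyBody.BoseGas.groundStateEnergy v N L + ENNReal.ofReal (s *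
τ * N)) ∧ (∀ v : ℝ → ENNReal,
Literature.MathematicalPhysics.QuantumManyBody.BoseGas.IsRepulsiveFiniteRange v → ∀ τ : ℝ, 0 < τ → ∃
θ ρ₀ : ℝ, 0 < θ ∧ θ ≤ 1 ∧ 0 < ρ₀ ∧ ∀ ρ : ℝ, 0 < ρ → ρ < ρ₀ → ∀ᶠ N : ℕ in Filter.atTop, let L : ℝ :=
Literature.MathematicalPhysics.QuantumManyBody.BoseGas.sideLength ρ N; let s₀ : ℝ := θ * ρ *
(Literature.MathematicalPhysics.QuantumManyBody.BoseGas.scatteringLength v).toReal; let R : ℝ →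
ENNReal := fun t => ⨅ Ψ : Literature.MathematicalPhysics.QuantumManyBody.BoseGas.TrialState N L,
(Literature.MathematicalPhysics.QuantumManyBody.BoseGas.energy v Ψ + ENNReal.ofReal t * ((N :
ENNReal) - Literature.MathematicalPhysics.QuantumManyBody.BoseGas.occupation N
(Literature.MathematicalPhysics.QuantumManyBody.BoseGas.constantMode L) Ψ.ψ)); R s₀ ≤
Literature.MathematicalPhysics.QuantumManyBody.BoseGas.groundStateEnergy v N L + ENNReal.ofReal (s₀
* τ * N) → ∀ s : ℝ, 0 < s → s ≤ s₀ → R s ≤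
Literature.MathematicalPhysics.QuantumManyBody.BoseGas.groundStateEnergy v N L + ENNReal.ofReal (2 *
τ * s * N))`

## Assembly
Pure logic, sorry-free in Sketch.lean / glue.lean (the deciding theorem `closes`): fix v repulsive
finite-range. Case scatteringLength v = 0:
FreeDirichletBEC gives HasGroundStateBEC v ρ for every ρ > 0 (take ρ₀ = 1). Case a ≠ 0: a.toReal > 0
by ScatteringLengthFinite; take τ = 1/8
in NudgeRemoval (θ ≤ 1, ρ₁) — NudgeRemoval itself is obtained as WalkGlue NudgedCondensation
NudgeGap CondensateVariance — then
NudgedCondensation with (1/8, θ) (ρ₂), GroundStateEnergyFinite (ρ₃), GroundStateRigidity (ρ₄); for ρ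
< min ρᵢ, `filter_upwards` the two
eventual sets: the rung at s₀ = θρa feeds the removal hypothesis (the `let`-bound terms coincide
syntactically), giving ∀ᶠN ∃s₀>0 ∀s≤s₀
R(s) ≤ E₀^D + 2τsN; WalkToBEC with the finiteness and rigidity filters yields HasGroundStateBEC v ρ,
i.e. the conjunct
`BoseEinsteinCondensation` (= `_root_.BoseEinsteinCondensation`, the sub-problem Statement decl).
NudgeGap, CondensateVariance enter through
WalkGlue, not through extra hypotheses.

Rationale: WHY THIS LINE. Lauwers–Verbeure–Zagrebnov proved BEC for interacting superstable bosons once the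
one-particle spectrum has a gap Δ ≥ Δ_min at k = 0 and
left the removal of the gap as the open problem (LauwersVerbeureZagrebnov2003, Thm 2 and §3;
Verbeure's monograph, panama:505294312439878
Ch. 4, ΔE = [x(x+2ρ₀v(0))]^(1/2)); this route is that programme at T = 0 made quantitative in the
variational Dirichlet setting of the
Statement: the reward −s·n̂₀ is U(1)- and particle-number-preserving, so (i) its top rung needs no
Δ_min — the PROVED facts
`LSSY2005_lowerBound_dirichlet_holds` (LSSY2005 Thm 2.4, LiebYngvason1998) and the in-tree Jastrow
product state of
`LSSY2005_upperBound_periodic_holds` (LSSY2005 Thm 2.2, Dyson1957) localised by the in-tree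
Basti–Cenatiempo–Schlein cut-off
(`exists_dirichlet_le_periodic`, BastiCenatiempoSchlein2021 Lemma A.1) already condense the nudged
gas at s = θρa ≪ μ = 8πρa, because
the Jastrow state ∏φ(x_i−x_j) (0 ≤ φ ≤ 1, defect I = ∫(1−φ²) = O(ab²)) has flat-mode fraction ≥ (1 −
N·I/L³ − 6/M)² by a two-line
POINTWISE bound (∫_Λ Ψ(x,X′)dx ≥ G(X′)(L³ − N∫(1−φ) − |ramps|), ∫Ψ² dx ≤ G²L³) — no LHY input, no
cluster expansion (this replaces the
card's coherent-replication step, flagged load-bearing by audit 6); (ii) the descent s ↓ 0 is an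
analytic-perturbation / Hellmann–Feynman
walk (Kato1966; convexity in a source as in Griffiths1966 and LiebSeiringerYngvason2005 App. D):
because the source couples to a₀†a₀, the
SQUARE of the order parameter, its left Griffiths limit is trivial and only a quantitative removal
can work — the gap of H + s·n̂₊ opens
like √(2μs) (Bogoliubov E_k = √((k²+s)(k²+s+2μ)), the Gell-Mann–Oakes–Renner square root: mass² ∝
explicit breaking) and Var(n̂₀) =
Σ2u_k²v_k² = 2√π√(ρa³)N is infrared-finite exactly in d = 3, so χ ≤ 2Var/Δ ≲ √(ρa³)N/√(ρa·s) is
integrable and the walk costs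
2√θ·√(ρa³)·N (Bogoliubov value) — the built-in dimension test: Var(n̂₀) ∝ log(1/s) in d = 2 (still
integrable), ∝ s^(-1/2)L in d = 1
(divergent: no conclusion, as it must be). Imported: analytic perturbation theory of isolated
eigenvalues, Ky-Fan's variational
characterisation of λ₀+λ₁ and Temple-type second-order lower bounds (operator theory); the
quasi-average philosophy of Bogoliubov/Griffiths
with a gauge-INVARIANT source; chiral perturbation theory only as the structural analogy for Δ ∝ √s;
stability-of-gapped-ground-states
technology (HastingsWen2005, BachmannMichalakisNachtergaeleSims2012) as the natural toolbox for
NudgeGap along a uniformly gapped family.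
What no other route does: every open route either works on the torus and pays BoundaryTransferWeak
(stmt-0827, wanted by 48 routes,
'transfer ≈ conjunct'), or needs positivity / Feynman–Kac / landscape functions; here TL-BEC of the
conjunct's own Dirichlet ground state
is reduced to Bogoliubov spectral statements for states ALREADY condensed (by the bootstrap) and
BULK-GAPPED (by the nudge) — the most
accessible open spectral problem in the subject (BoccatoEtAl2019Acta,
BrenneckeCaporalettiSchlein2022 in GP/GP+κ boxes;
DerezinskiNapiorkowski2014 in the mean-field TL) — and the retired torus twin BECRewardWalk (closed
not-a-thesis on form) is superseded
with two items fewer. Negatives index (6 entries, 1 in this sub: SwapJensen stmt-3980) is untouched: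
no Jensen/entropy step here.

RANKED CRUXES. #2 NudgeGap (crux) — (cards G / BOOT(a)) for every repulsive finite-range v there are
η, c, ρ₀ > 0 such that for 0 < ρ < ρ₀, all large N (L = (N/ρ)^(1/3)) and every nudge 0 < s ≤ ρa: IF
the near-minimisers of F_s are (1−η)-condensed in the flat mode (∃δ>0: F_s(Ψ) ≤ R(s)+δ ⇒ n₀(Ψ) ≥
(1−η)N) THEN F_s has spectral gap ≥ c√(ρa·s) above R(s), in Ky-Fan form: F_s(Φ₁) + F_s(Φ₂) ≥ 2R(s) +
c√(ρa·s) for every pair of L²-orthogonal Dirichlet trial states. Bogoliubov value: lowest mode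
√((k₁²+s)(k₁²+s+16πρa)) ≥ 4√π·√(ρa·s), k₁ = π/L, surface modes ≥ O(μ); δ is chosen after N
(exact-ground-state property, below every Galilei-boost witness). [difficulty: open-problem] (why it
might fail: TL Bogoliubov gaps for condensed bulk-gapped gases are proved only in GP/GP+κ boxes; at
L=(N/ρ)^(1/3) cubic/quartic terms are not norm-small, and a soft two-phonon/surface mode below c√(ρa
s), or a degenerate hard-core ground space (Ky-Fan gap 0 as s→0), refutes c uniform in N, s.)
[BoccatoEtAl2019Acta, BrenneckeCaporalettiSchlein2022, DerezinskiNapiorkowski2014, Seiringer2011,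
LauwersVerbeureZagrebnov2003, HastingsWen2005, BachmannMichalakisNachtergaeleSims2012, LSSY2005]
#3 CondensateVariance (crux) — (cards V / BOOT(b); the dimension carrier) for every repulsive
finite-range v there are η, C, ρ₀ > 0 such that for 0 < ρ < ρ₀, all large N and every 0 < s ≤ ρa: IF
the near-minimisers of F_s are (1−η)-condensed THEN for some δ > 0 every δ-near-minimiser Ψ of F_s
has ⟨Ψ, n̂₀²Ψ⟩ ≤ ⟨Ψ, n̂₀Ψ⟩² + C·N, i.e. Var_Ψ(n̂₀) ≤ CN, where ⟨Ψ,n̂₀²Ψ⟩ = ‖Σ_i P_iΨ‖² = ∫ |Σ_i L⁻³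
1_Λ(x_i) ∫_Λ Ψ(X[i↦y]) dy|² dX. Bogoliubov value 2√π·√(ρa³)·N + O(ξ/L)N, infrared-finite (∫d³k/k²)
exactly in d = 3, even decreasing in s; FALSE in d = 1 (∝ s^(-1/2)), log(1/s) in d = 2. [difficulty:
XL] (why it might fail: needs a 4-point bound for condensed states at TL box size, quartic in
excitation operators — exactly where TL Bogoliubov control is missing; Var(n̂₀) ≫ N along the path
by a POWER of 1/s or L (cf. GPS 1998 anomalous N^(4/3) at T>0) breaks the walk; a log would be
repairable.) [GiorginiPitaevskiiStringari1998, BoccatoEtAl2019Acta, BrenneckeCaporalettiSchlein2022,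
LiebSeiringerYngvason2005, LSSY2005]
#4 NudgeRemoval (crux) — (card REMOVAL / sibling WALK, output form) for every repulsive finite-range
v and every τ > 0 there are θ ∈ (0,1] and ρ₀ > 0 such that for 0 < ρ < ρ₀ and all large N, with s₀
:= θρa: R(s₀) ≤ E₀^D + s₀τN implies R(s) ≤ E₀^D + 2τsN for all 0 < s ≤ s₀. Equivalently (R concave,
R(0) = E₀^D) the flat-mode depletion R′(0⁺)/N of the true Dirichlet ground state exceeds that of the
nudged one by at most τ: ∫₀^(s₀) χ(s)ds ≤ τN with χ = −R″. Bogoliubov value of the loss 2√θ·√(ρa³) ≪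
τ. Vacuous when a = 0. [deps: NudgedCondensation, NudgeGap, CondensateVariance, WalkGlue]
[difficulty: open-problem] (why it might fail: unconditional TL statement: with the rung and
rigidity it yields Dirichlet BEC, so off the WalkGlue path it is as hard as the conjunct; false iff
removing a reward ≤ θμ/8π raises the ground-state flat-mode depletion by ≥ τN at arbitrarily small ρ
— a non-integrable susceptibility, as in d ≤ 2.) [LauwersVerbeureZagrebnov2003, Kato1966,
Griffiths1966, LiebSeiringerYngvason2005, Suto2005, LSSY2005]
#5 NudgedCondensation (crux) — (card RUNG, leading-order form) for every repulsive finite-range v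
and all τ, θ > 0 there is ρ₀ > 0 such that for 0 < ρ < ρ₀ and all large N (L = (N/ρ)^(1/3), s =
θρa): R(s) ≤ E₀^D(N,L) + sτN. Consequently the s-nudged Dirichlet ground state has flat-mode
depletion ≤ τN: thermodynamic-limit condensation of the REWARDED gas at a price s with s/μ = θ/8π
arbitrarily small. Proof route (all inputs in tree): E₀^D ≥ 4πρa(1 − 64Y^(1/17))N
(LSSY2005_lowerBound_dirichlet_holds); trial state = the periodic Jastrow product
IsPairProfile.trialState (LSSY2005_dysonProfile_holds, LSSY2005_jastrowBound_holds: energy ≤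
4πρ′a(1+12a/b)N on the torus of side L·M/(M+1)) multiplied by the smooth partition-of-unity cut-off
of exists_dirichlet_le_periodic (energy factor 1+4/M plus 4CNM/L²), whose flat-mode occupation is ≥
(1 − 6/M − N·∫(1−φ)/L³)²N by the pointwise bound of § Why this line; choose η(θ,τ), M = ⌊√L⌋, Y
small. Trivially true when a = 0 (s = 0). [deps: ScatteringLengthFinite] [difficulty: M] (why it
might fail: a>0 settled on paper (pointwise Jastrow bound); risks: the Dirichlet wall (flat mode ≠
condensate mode within ξ of ∂Λ: deficit 6/M + NI/L³ ≤ η uniformly in N), LY's threshold Y <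
(a/(2R₀+a))^(17/5), and extracting the explicit cut-off STATE from exists_dirichlet_le_periodic
(stated for infima).) [LSSY2005, LiebYngvason1998, Dyson1957, BastiCenatiempoSchlein2021,
Fournais2020, LauwersVerbeureZagrebnov2003, PenroseOnsager1956]
#6 GroundStateRigidity (crux) — (shared verbatim with stmt-AtomisticToContinuum-3298, phase rigidity
of the Dirichlet ground state) ∀ admissible v ∃ρ₀ ∀ρ<ρ₀ ∀ᶠN ∀η>0 ∃δ>0: any two δ-near-minimisers Ψ,
Φ ∈ TrialState N L satisfy ∫|Ψ − cΦ|² ≤ η for some unit complex c (E₀ < ∞, compact resolvent, unique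
positive ground state and spectral gap of the Dirichlet N-body problem at fixed N; hard cores via
connectedness / energetic dominance of the dilute component). Needed because condensateNumber is an
infimum over ALL near-minimisers while the walk controls the s → 0⁺ limit of the nudged minimisers.
[difficulty: M] (why it might fail: hard cores (v = ⊤ shells) disconnect the N-sphere configuration
space; uniqueness then needs every non-dilute component (jammed/bound clusters) an N-uniform gap
above E₀ — low-density connectivity is open in general; Perron–Frobenius for H_N is not in Mathlib.)
[ReedSimonIV1978, Kato1966, LSSY2005]
#9 WalkGlue (support) — (glue of the foreseen split NudgeRemoval ⇐ NudgedCondensation, NudgeGap,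
CondensateVariance; kind glue, filed as support so the finite-N spectral bookkeeping can start)
NudgedCondensation → NudgeGap → CondensateVariance → NudgeRemoval. Content, all at fixed (N, L): H_s
= H + s(N − n̂₀) on the Dirichlet box has compact resolvent and, for s > 0, a positivity-improving
semigroup (the reward's kernel L⁻³ > 0 teleports one particle anywhere, across hard-core components
too), so Ψ_s is unique, s ↦ R(s) is real-analytic and concave on (0,∞) with R′(s) = N − n₀(Ψ_s) and
−R″(s) = 2Σ_m |⟨m|n̂₀|Ψ_s⟩|²/(E_m − E_s) ≤ 2Var_(Ψ_s)(n̂₀)/Δ(s) (Kato II §6; Temple/Ky-Fan give the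
variational form matching NudgeGap); bootstrap: given η, c, C take τ ≤ η/4 and θ := min(1,
(c·min(τ,η/4)/4C)²); s* = inf{s : n₊(Ψ_s′) ≤ ηN/2 on [s, s₀]} is 0 because the rung bounds
n₊(Ψ_(s₀)) ≤ τN ≤ ηN/4 (concavity: s₀R′(s₀) ≤ R(s₀) − R(0)) and ∫ 2CN/(c√(ρa s)) ds ≤ (4C√θ/c)N ≤
min(τ, η/4)N; then R(s) ≤ R(0) + sR′(0⁺) ≤ E₀^D + s(R′(s₀⁻) + ∫χ) ≤ E₀^D + 2τsN. [difficulty: L]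
[Kato1966, ReedSimonIV1978, Griffiths1966, LiebSeiringerYngvason2005]
#9 WalkToBEC (support) — (from the walk output at one density to BEC at that density; pure finite-N
bookkeeping + L²-continuity of the occupation) for admissible v with 0 < a < ∞, ρ > 0, 0 < τ ≤ 1/8:
if eventually E₀^D(N,L) < ⊤, eventually [∃ s₀ > 0 ∀ s ∈ (0,s₀]: R(s) ≤ E₀^D + 2τsN], and eventually
[the GroundStateRigidity body at N], then HasGroundStateBEC v ρ (with c = 1/2). Proof: fix large N,
take η = 1/400 and δ from rigidity, then s ≤ s₀ with 3τsN < δ; iInf_lt_iff gives Ψ with F_s(Ψ) <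
E₀^D + 3τsN, hence energy(Ψ) ≤ E₀^D + δ and n₀(Ψ) > (1−3τ)N (cancel the finite energy in ℝ≥0∞);
every δ-near-minimiser Φ is η-close to cΨ, and √n₀ is √N-Lipschitz in L² (n₀(Ψ) = N‖TΨ‖², T =
contraction against φ₀), so n₀(Φ) ≥ (√(5/8) − 1/20)²N ≥ N/2; occupation_le_maxOccupation
(constantMode measurable, normalised by volume_cell) and le_condensateNumber finish. [difficulty: M]
[LSSY2005, ReedSimonIV1978]
#9 FreeDirichletBEC (support) — (the degenerate case a = 0, where s₀ = 0 and the flat mode is the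
WRONG mode: the free Dirichlet ground state is the sine product, flat-mode fraction (8/π²)³ ≈ 0.53)
for admissible v with scatteringLength v = 0 and every ρ > 0, HasGroundStateBEC v ρ (c = 1/2).
Proof: v(|x|) = 0 a.e. (LSSY2005_zeroScatteringLength_holds, proved), so energy = kinetic; odd
reflection to the torus of side 2L and Parseval there (PeriodicBoseGasFourier) give the Dirichlet
cube bounds Σ_i∫|∇_iΨ|² ≥ 3π²N/L² + (3π²/L²)(N − n_sine(Ψ)) for C¹ Ψ vanishing off Λ^N and E₀^D ≤
3π²N/L²(1+ε) (mollified sine product); δ := 3π²N/(2L²) gives n_sine ≥ N/2 for every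
δ-near-minimiser, and le_condensateNumber. [difficulty: M] [LSSY2005, Fournais2020]
#9 GroundStateEnergyFinite (support) — (shared verbatim with stmt-AtomisticToContinuum-0850) for
repulsive finite-range v (range R₀) there is ρ₀ > 0 such that for ρ < ρ₀ and all large N the
Dirichlet ground-state energy at L = (N/ρ)^(1/3) is finite: one symmetric C¹ trial state of N
disjoint bumps at mutual distance > R₀ (interaction_eq_zero_of_lt_dist; TrialState.combine machinery
in tree). Needed by WalkToBEC to cancel finite terms in ℝ≥0∞. [difficulty: provable-now] [LSSY2005]
#9 ScatteringLengthFinite (support) — (shared verbatim with stmt-AtomisticToContinuum-0851; a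
grounder's sorry-free proof is attached to that item) finite range ⇒ scatteringLength v ≠ ⊤ (trial φ
∈ C¹, φ = 0 on B_R₀, φ = 1 off B_(R₀+1); hard cores fine since ⊤·0 = 0). Needed to read a :=
(scatteringLength v).toReal > 0 in the case split of the deciding theorem. [difficulty:
provable-now] [LSSY2005]

TWO-LAYER PLAN. Foreseen glued splits (k ≤ 3, depth 1), nothing beyond WalkGlue filed now:
NudgeRemoval ⇐ NudgedCondensation → NudgeGap →
CondensateVariance → NudgeRemoval (glue = WalkGlue, filed as support). NudgeGap ⇐ LocalMassiveGap
(Bogoliubov gap on Fournais/Junge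
sub-boxes ℓ ~ (ρa)^(-1/2)(ρa³)^(-η) for condensed states, where BBCS technology works; the nudge
mass √(μs) ≫ c_s/ℓ decouples boxes) →
MassGluing (IMS localisation error ℓ⁻² ≪ √(μs) for s ≫ 1/(μℓ⁴)) → NudgeGap; the leftover window s ≲
1/(μℓ⁴) … L⁻² is a finite-size
Landau-type statement E₁ − E₀ ≳ √μ/L shared in substance with cards sector-gap-no-cheap-momentum /
landau-to-infrared-bound.
CondensateVariance ⇐ LocalVariance (4-point Bogoliubov bound per massive box) → VarianceGluing
(exponential decoupling at mass √(μs)) →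
CondensateVariance. A symmetric-sector weakening of NudgeGap (only O_h-invariant pairs matter for χ)
is the first repair if a
non-invariant soft mode is exhibited.

KILL CRITERIA. CondensateVariance refuted in d = 3 by a POWER (Var(n̂₀) ≥ N·s^(-α) or N·L^α along
the nudge path for condensed states) — close
`refuted:CondensateVariance`: the reward family is non-integrable and the sibling card dies with it.
NudgeRemoval refuted (a reward ≤ θμ/8π
whose removal costs ≥ τN depletion at arbitrarily small ρ) — close outright. NudgeGap refuted by a
soft mode: pivot first to the
O_h-symmetric-sector version, then to the integrated form ∫₀^(s₀) Var/(NΔ) ds ≤ τ as a single crux;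
refuted by hard-core degeneracy only:
restate for finite v (misstated class). GroundStateRigidity refuted for hard cores: same
restriction, shared with the 7 other routes wanting
stmt-3298. NudgedCondensation cannot be refuted for a > 0 (proof on paper); a typing refutation is
repaired by restatement. Mooted if any
Dirichlet-box route closes the conjunct, or if PeriodicBEC + BoundaryTransferWeak (stmt-0827) are
both proved.

NOT DECOMPOSED YET. The explicit Dirichlet trial state of the rung (CondensedDirichletTrial: energy
≤ 4πρa(1+η)N ∧ n₀ ≥ (1−η)N) — a helper lemma riding with
`--supports NudgedCondensation`, not an item; the √N-Lipschitz continuity of √n₀ and the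
normalisation of constantMode (helpers of
WalkToBEC); the finite-N operator theory behind WalkGlue (self-adjoint realisation of H_s on the C¹
Dirichlet core, Kato analyticity of
the simple ground eigenvalue for s > 0, Temple's inequality in Ky-Fan form) — provers attach these
as support lemmas; the constants c, C,
θ = (c·τ/4C)² and the LocalMassiveGap / MassGluing children of NudgeGap (Two-layer plan); the
log-tolerant variant of CondensateVariance;
an LHY-precision version of the rung (nudge o(LHY) per particle, the card's headline) — it needs the
UNPROVED facts
BCS2021_lhyUpperBound_dirichlet / Fournais–Solovej and is deliberately not on the critical path.

CHEAPEST FALSIFIER. (a) Bogoliubov bookkeeping in the DIRICHLET box including surface modes: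
recompute ∫₀^(θρa) 2Var_s(n̂₀)/(N·Δ(s)) ds with the exact
E_k(s) = √((k²+s)(k²+s+2μ)) and the boundary-layer condensate (flat mode vs GP profile, overlap 1 −
O(ξ/L)); the route needs it O(√θ)
uniformly in L — planner's value 2√θ√(ρa³); a surface branch with gap O(s) instead of O(√(μs)) AND
weight Θ(N) in Var would kill
NudgeGap as typed (then: symmetric-sector repair). (b) Exact diagonalisation, N ≤ 8 bosons on a
4³–6³ lattice with open boundary and
on-site/n.n. repulsion: R(s), n₀(Ψ_s), Var_s(n̂₀) versus s and L — a variance growing with L at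
small s in 3-D retires CondensateVariance
(kit job, hours; not run here: hub is compute-free for planners in plancard mode). (c) Sanity (done,
by hand): for the FREE gas the scheme
must fail and does — s₀ = θρa = 0, and R(s) ≤ E₀ + 2τsN is false at fixed N for s ≲ 1/(τ²L²) because
the sine ground state has flat-mode
depletion 0.47N; FreeDirichletBEC covers it through the sine mode. (d) Lookup: any theorem or
numerics giving Var(N₀) ≫ N at T = 0 in
3-D (GiorginiPitaevskiiStringari1998 is T > 0: ⟨δN₀²⟩ ∝ T) — none found.

NUMBERS. μ = 8πρa (ħ = 2m = 1); Bogoliubov gap of H + s·n̂₊: √(s(s+2μ)) ≥ √(16πρa·s), so c ≤ 4√π ≈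
7.09 in NudgeGap; depletion
(8/(3√π))√(ρa³) ≈ 1.505√(ρa³); Var(n̂₀)/N = 2Σu_k²v_k²/N = 2√π√(ρa³) ≈ 3.545√(ρa³) (3-D, T = 0, s =
0; decreasing in s); walk loss
∫₀^(θρa) 2Var/(NΔ) = 2√θ·√(ρa³); rung budget: LY error 64Y^(1/17) (Y = 4πρa³/3 < (a/(2R₀+a))^(17/5),
L/a > Y^(-6/17)), Jastrow error
12a/b with (N−1)·16πaβ² = (3/4)(a/b)L³ (in-tree constants), cut-off factor 1 + 4/M and 4CNM/L²;
flat-mode fraction of the free Dirichlet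
ground state (8/π²)³ = 0.533. Items at open: 11 (5 cruxes, 5 support, 1 assembly).

DEFINITION REQUESTS. None. Everything is typed over existing declarations: TrialState, energy,
groundStateEnergy, occupation, maxOccupation (via
HasGroundStateBEC), constantMode, cell, sideLength, scatteringLength, IsRepulsiveFiniteRange
(Literature.MathematicalPhysics.QuantumManyBody.{BoseEinsteinCondensation, PeriodicBoseGas}).
⟨Ψ,n̂₀²Ψ⟩ is written inline as ∫⁻‖Σ_i L⁻³1_Λ(x_i)∫_Λ Ψ(update X i y)dy‖². A named
`pairOccupation`/`nudgedEnergy` API would shorten the signatures and may be requested by provers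
(`--kind definition --topic
Literature/MathematicalPhysics/QuantumManyBody`), but is not needed to state or prove anything here.

Novelty: Searches (2026-08-15, this seat; `lit search`/searchd was unavailable, rc 75, during the session —
noted in NOTES.md): `lit galaxy search
"one-particle spectral gap" --star all` (3 rows: Verbeure, Many-Body Boson Systems,
panama:505294312439878 — read chars 296121–305121:
Ch. 4 superstable Bogoliubov model, gap ΔE = [x(x+2ρ₀v(0))]^(1/2), 'an interaction able to create a
spectral gap (see Eq. (4.2))'; a J.
Phys. A scan; an unrelated microcavity book); `lit galaxy search "condensation for interacting gases
with a one-particle spectral gap"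
--star all` (0); in-book searches "superstable", "energy gap", "gap tends to zero" (0/0/0); `lit
vsearch` ×2 (LVZ-type statement; variance/gap
susceptibility bound) — only textbooks (Pethick–Smith, LSSY2005 pp. 4/95/142, Griffin 1995,
Verbeure), nothing combining a short-range
gas with a removable U(1)-invariant reward; the card's own searches (crossref/zbMATH
"Huang–Yang–Luttinger condensation pressure",
"quasi-average Lee–Huang–Yang condensation mean-field perturbation dilute", zbMATH "proof
Bose–Einstein condensation interacting
thermodynamic limit" since 2005, galaxy "charged Bose gas") and four refuter novelty audits
(6/14/29/36) whose blind prior-art guess and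
finding was LVZ 2003. In-tree: 22 open gen-2 routes grepped for reward|nudge (0 hits); retired twin
BECRewardWalk read in full.
Nearest prior art found: LauwersVerbeureZagrebnov2003 (doi:10.1088/0305-4470/36/11/102; BEC for
superstable interacting gases with a
one-particle gap at  [refs: 10.1088/0305-4470/36/11/102, 10.1007/bf02108780, doi:10.1088/0305-4470/36/11/102, doi:10.1007/bf02108780, LSSY2005, LauwersVerbeureZagrebnov2003, LiebSeiringerYngvason2005]

Barriers (technique_class: quasi-average gap-regulator susceptibility-walk): - technique_class: quasi-average gap-regulator susceptibility-walk
- Literature.Barriers.AtomisticToContinuum.SymmetryBreakingWithoutCondensateNarrow: evaded by INPUT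
and by SCOPE — the narrowed entry blocks any argument whose further input is valid for the perfect
gas at 0 < β < ∞ in every power-law box (pressure-level, shape-insensitive source arguments); this
route's further input is NudgeGap ∧ CondensateVariance along the nudged family plus phase rigidity,
in CUBES at T = 0 with the conclusion an explicit single mode — input that is FALSE for the
Casimir-box free gas at T > 0 (its o(V⁻¹)-band of levels makes Var/gap non-integrable), so the
witnesses (a)–(b) are excluded rather than overlooked; no gauge-broken state, pressure or c-number
substitution appears, and the entry itself records cubes / interacting / T = 0 as open, not blocked.
- Literature.Barriers.AtomisticToContinuum.SymmetryBreakingWithoutCondensate: met head-on in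
U(1)-INVARIANT form — the source −s·n̂₀ conserves particle number, so there is no
c-number/coherent-weight tilt and no (D.17)-type one-sided limit interchange; the left Griffiths
limit of a source coupling to |order parameter|² is trivial, which is exactly why the route proves a
QUANTITATIVE removal (∫χ ≤ τN from gap × variance) instead of a convexity argument; the barrier's
witnesses ((D.19) weights, Casimir-box free gas at T > 0) have non-integrable susceptibility and are
excluded by NudgeGap/CondensateVariance, not assumed away.
- Literature.Barr

History (route lifecycle, newest last):
- 2026-08-25T09:09:06Z · DORMANT — reconciler: no traction for 7.6 d (last activity item-evidence-added at 2026-08-17T19:09:23Z); parked, not closed — `ledger route dormant route-AtomisticToConti (operator:999:3776522)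

sub-problem: BoseEinsteinCondensation · status: dormant · opened planner-plancard-AtomisticToContinuum-BoseEin-fe00e879-g2-0 2026-08-15T19:07:41Z · rev 3 · ledger route-AtomisticToContinuum-BECNudgeWalk
GENERATED by the gate from the ledger (D-0016/17). Provers cite these decls: `theorem foo : Summit.AtomisticToContinuum.BoseEinsteinCondensation.Theses.BECNudgeWalk.<Decl> := …` in Summits/AtomisticToContinuum/BoseEinsteinCondensation/Theorems/<Name>.lean.
-/

namespace Summit.AtomisticToContinuum.BoseEinsteinCondensation.Theses.BECNudgeWalk

open scoped BigOperators Topology Manifold Classical MeasureTheory ProbabilityTheory Matrix InnerProductSpace ComplexConjugate ContinuousMap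
open Filter Set Function TopologicalSpace MeasureTheory

attribute [summit_statement] _root_.BoseEinsteinCondensation

/-- item stmt-AtomisticToContinuum-14359 · crux · rank 2 · open · by planner
why it might fail: TL Bogoliubov gaps for condensed bulk-gapped gases are proved only in GP/GP+κ boxes; at L=(N/ρ)^(1/3) cubic/quartic terms are not norm-small, and a soft two-phonon/surface mode below c√(ρa s), or a degenerate hard-core ground space (Ky-Fan gap 0 as s→0), refutes c uniform in N, s.
sources: BoccatoEtAl2019Acta, BrenneckeCaporalettiSchlein2022, DerezinskiNapiorkowski2014, Seiringer2011, LauwersVerbeureZagrebnov2003, HastingsWen2005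
[crux] (cards G / BOOT(a)) for every repulsive finite-range v there are η, c, ρ₀ > 0 such that for 0
< ρ < ρ₀, all large N (L = (N/ρ)^(1/3)) and every nudge 0 < s ≤ ρa: IF the near-minimisers of F_s
are (1−η)-condensed in the flat mode (∃δ>0: F_s(Ψ) ≤ R(s)+δ ⇒ n₀(Ψ) ≥ (1−η)N) THEN F_s has spectral
gap ≥ c√(ρa·s) above R(s), in Ky-Fan form: F_s(Φ₁) + F_s(Φ₂) ≥ 2R(s) + c√(ρa·s) for every pair of
L²-orthogonal Dirichlet trial states. Bogoliubov value: lowest mode √((k₁²+s)(k₁²+s+16πρa)) ≥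
4√π·√(ρa·s), k₁ = π/L, surface modes ≥ O(μ); δ is chosen after N (exact-ground-state property, below
every Galilei-boost witness). [difficulty: open-problem] -/
@[route_item "route-AtomisticToContinuum-BECNudgeWalk"]
def NudgeGap : Prop :=
  ∀ v : ℝ → ENNReal, Literature.MathematicalPhysics.QuantumManyBody.BoseGas.IsRepulsiveFiniteRange v → ∃ η c ρ₀ : ℝ, 0 < η ∧ 0 < c ∧ 0 < ρ₀ ∧ ∀ ρ : ℝ, 0 < ρ → ρ < ρ₀ → ∀ᶠ N : ℕ in Filter.atTop, ∀ s : ℝ, 0 < s → s ≤ ρ * (Literature.MathematicalPhysics.QuantumManyBody.BoseGas.scatteringLength v).toReal → let L : ℝ := Literature.MathematicalPhysics.QuantumManyBody.BoseGas.sideLength ρ N; let F : Literature.MathematicalPhysics.QuantumManyBody.BoseGas.TrialState N L → ENNReal := fun Ψ => Literature.MathematicalPhysics.QuantumManyBody.BoseGas.energy v Ψ + ENNReal.ofReal s * ((N : ENNReal) - Literature.MathematicalPhysics.QuantumManyBody.BoseGas.occupation N (Literature.MathematicalPhysics.QuantumManyBody.BoseGas.constantMode L) Ψ.ψ); (∃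 δ : ENNReal, 0 < δ ∧ ∀ Ψ : Literature.MathematicalPhysics.QuantumManyBody.BoseGas.TrialState N L, F Ψ ≤ (⨅ Φ : Literature.MathematicalPhysics.QuantumManyBody.BoseGas.TrialState N L, F Φ) + δ → ENNReal.ofReal ((1 - η) * N) ≤ Literature.MathematicalPhysics.QuantumManyBody.BoseGas.occupation N (Literature.MathematicalPhysics.QuantumManyBody.BoseGas.constantMode L) Ψ.ψ) → ∀ Φ₁ Φ₂ : Literature.MathematicalPhysics.QuantumManyBody.BoseGas.TrialState N L, (∫ X, (starRingEnd ℂ) (Φ₁.ψ X) * Φ₂.ψ X) = 0 → 2 * (⨅ Φ : Literature.MathematicalPhysics.QuantumManyBody.BoseGas.TrialState N L, F Φ) + ENNReal.ofReal (c * Real.sqrt (ρ * (Literature.MathematicalPhysics.QuantumManyBody.BoseGas.scatteringLength v).toReal * s)) ≤ F Φ₁ + F Φ₂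

/-- item stmt-AtomisticToContinuum-14360 · crux · rank 3 · open · by planner
why it might fail: needs a 4-point bound for condensed states at TL box size, quartic in excitation operators — exactly where TL Bogoliubov control is missing; Var(n̂₀) ≫ N along the path by a POWER of 1/s or L (cf. GPS 1998 anomalous N^(4/3) at T>0) breaks the walk; a log would be repairable.
sources: GiorginiPitaevskiiStringari1998, BoccatoEtAl2019Acta, BrenneckeCaporalettiSchlein2022, LiebSeiringerYngvason2005, LSSY2005
[crux] (cards V / BOOT(b); the dimension carrier) for every repulsive finite-range v there are η, C,
ρ₀ > 0 such that for 0 < ρ < ρ₀, all large N and every 0 < s ≤ ρa: IF the near-minimisers of F_s are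
(1−η)-condensed THEN for some δ > 0 every δ-near-minimiser Ψ of F_s has ⟨Ψ, n̂₀²Ψ⟩ ≤ ⟨Ψ, n̂₀Ψ⟩² +
C·N, i.e. Var_Ψ(n̂₀) ≤ CN, where ⟨Ψ,n̂₀²Ψ⟩ = ‖Σ_i P_iΨ‖² = ∫ |Σ_i L⁻³ 1_Λ(x_i) ∫_Λ Ψ(X[i↦y]) dy|²
dX. Bogoliubov value 2√π·√(ρa³)·N + O(ξ/L)N, infrared-finite (∫d³k/k²) exactly in d = 3, even
decreasing in s; FALSE in d = 1 (∝ s^(-1/2)), log(1/s) in d = 2. [difficulty: XL] -/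
@[route_item "route-AtomisticToContinuum-BECNudgeWalk"]
def CondensateVariance : Prop :=
  ∀ v : ℝ → ENNReal, Literature.MathematicalPhysics.QuantumManyBody.BoseGas.IsRepulsiveFiniteRange v → ∃ η C ρ₀ : ℝ, 0 < η ∧ 0 < C ∧ 0 < ρ₀ ∧ ∀ ρ : ℝ, 0 < ρ → ρ < ρ₀ → ∀ᶠ N : ℕ in Filter.atTop, ∀ s : ℝ, 0 < s → s ≤ ρ * (Literature.MathematicalPhysics.QuantumManyBody.BoseGas.scatteringLength v).toReal → let L : ℝ := Literature.MathematicalPhysics.QuantumManyBody.BoseGas.sideLength ρ N; let F : Literature.MathematicalPhysics.QuantumManyBody.BoseGas.TrialState N L → ENNReal := fun Ψ => Literature.MathematicalPhysics.QuantumManyBody.BoseGas.energy v Ψ + ENNReal.ofReal s * ((N : ENNReal) - Literature.MathematicalPhysics.QuantumManyBody.BoseGas.occupation N (Literature.MathematicalPhysics.QuantumManyBody.BoseGas.constantMode L) Ψ.ψ); (∃ δ : ENNReal, 0 < δ ∧ ∀ Ψ : Literature.MathematicalPhysics.QuantumManyBody.BoseGas.TrialState N L, F Ψ ≤ (⨅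 Φ : Literature.MathematicalPhysics.QuantumManyBody.BoseGas.TrialState N L, F Φ) + δ → ENNReal.ofReal ((1 - η) * N) ≤ Literature.MathematicalPhysics.QuantumManyBody.BoseGas.occupation N (Literature.MathematicalPhysics.QuantumManyBody.BoseGas.constantMode L) Ψ.ψ) → ∃ δ : ENNReal, 0 < δ ∧ ∀ Ψ : Literature.MathematicalPhysics.QuantumManyBody.BoseGas.TrialState N L, F Ψ ≤ (⨅ Φ : Literature.MathematicalPhysics.QuantumManyBody.BoseGas.TrialState N L, F Φ) + δ → (∫⁻ X, (‖∑ i : Fin N, (((L ^ 3)⁻¹ : ℝ) : ℂ) * (Literature.MathematicalPhysics.QuantumManyBody.BoseGas.cell L).indicator (fun _ => (1 : ℂ)) (X i) * ∫ y in Literature.MathematicalPhysics.QuantumManyBody.BoseGas.cell L, Ψ.ψ (Function.update X i y)‖₊ : ENNReal) ^ 2) ≤ Literature.MathematicalPhysics.QuantumManyBody.BoseGas.occupation N (Literature.MathematicalPhysics.QuantumManyBody.BoseGas.constantMode L) Ψ.ψ ^ 2 + ENNReal.ofReal (C * N)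

/-- item stmt-AtomisticToContinuum-14361 · crux · rank 4 · open · by planner
why it might fail: unconditional TL statement: with the rung and rigidity it yields Dirichlet BEC, so off the WalkGlue path it is as hard as the conjunct; false iff removing a reward ≤ θμ/8π raises the ground-state flat-mode depletion by ≥ τN at arbitrarily small ρ — a non-integrable susceptibility, as in d ≤ 2.
sources: LauwersVerbeureZagrebnov2003, Kato1966, Griffiths1966, LiebSeiringerYngvason2005, Suto2005, LSSY2005
[crux] (card REMOVAL / sibling WALK, output form) for every repulsive finite-range v and every τ > 0
there are θ ∈ (0,1] and ρ₀ > 0 such that for 0 < ρ < ρ₀ and all large N, with s₀ := θρa: R(s₀) ≤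
E₀^D + s₀τN implies R(s) ≤ E₀^D + 2τsN for all 0 < s ≤ s₀. Equivalently (R concave, R(0) = E₀^D) the
flat-mode depletion R′(0⁺)/N of the true Dirichlet ground state exceeds that of the nudged one by at
most τ: ∫₀^(s₀) χ(s)ds ≤ τN with χ = −R″. Bogoliubov value of the loss 2√θ·√(ρa³) ≪ τ. Vacuous when
a = 0. [deps: NudgedCondensation, NudgeGap, CondensateVariance, WalkGlue] [difficulty: open-problem] -/
@[route_item "route-AtomisticToContinuum-BECNudgeWalk", crux]
def NudgeRemoval : Prop :=
  ∀ v : ℝ → ENNReal, Literature.MathematicalPhysics.QuantumManyBody.BoseGas.IsRepulsiveFiniteRange v → ∀ τ : ℝ, 0 < τ → ∃ θ ρ₀ : ℝ, 0 < θ ∧ θ ≤ 1 ∧ 0 < ρ₀ ∧ ∀ ρ : ℝ, 0 < ρ → ρ < ρ₀ → ∀ᶠ N : ℕ in Filter.atTop, let L : ℝ := Literature.MathematicalPhysics.QuantumManyBody.BoseGas.sideLength ρ N; let s₀ : ℝ := θ * ρ * (Literature.MathematicalPhysics.QuantumManyBody.BoseGas.scatteringLength v).toReal; let R : ℝ → ENNReal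 := fun t => ⨅ Ψ : Literature.MathematicalPhysics.QuantumManyBody.BoseGas.TrialState N L, (Literature.MathematicalPhysics.QuantumManyBody.BoseGas.energy v Ψ + ENNReal.ofReal t * ((N : ENNReal) - Literature.MathematicalPhysics.QuantumManyBody.BoseGas.occupation N (Literature.MathematicalPhysics.QuantumManyBody.BoseGas.constantMode L) Ψ.ψ)); R s₀ ≤ Literature.MathematicalPhysics.QuantumManyBody.BoseGas.groundStateEnergy v N L + ENNReal.ofReal (s₀ * τ * N) → ∀ s : ℝ, 0 < s → s ≤ s₀ → R s ≤ Literature.MathematicalPhysics.QuantumManyBody.BoseGas.groundStateEnergy v N L + ENNReal.ofReal (2 * τ * s * N)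

/-- item stmt-AtomisticToContinuum-14362 · crux · rank 5 · closed · proved by Summit.AtomisticToContinuum.BoseEinsteinCondensation.NudgedCondensationLine.NudgedCondensation_of @ e0786bdd22cd (prover) · by planner
why it might fail: a>0 settled on paper (pointwise Jastrow bound); risks: the Dirichlet wall (flat mode ≠ condensate mode within ξ of ∂Λ: deficit 6/M + NI/L³ ≤ η uniformly in N), LY's threshold Y < (a/(2R₀+a))^(17/5), and extracting the explicit cut-off STATE from exists_dirichlet_le_periodic (stated for infima).
sources: LSSY2005, LiebYngvason1998, Dyson1957, BastiCenatiempoSchlein2021, Fournais2020, LauwersVerbeureZagrebnov2003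
[crux] (card RUNG, leading-order form) for every repulsive finite-range v and all τ, θ > 0 there is
ρ₀ > 0 such that for 0 < ρ < ρ₀ and all large N (L = (N/ρ)^(1/3), s = θρa): R(s) ≤ E₀^D(N,L) + sτN.
Consequently the s-nudged Dirichlet ground state has flat-mode depletion ≤ τN: thermodynamic-limit
condensation of the REWARDED gas at a price s with s/μ = θ/8π arbitrarily small. Proof route (all
inputs in tree): E₀^D ≥ 4πρa(1 − 64Y^(1/17))N (LSSY2005_lowerBound_dirichlet_holds); trial state =
the periodic Jastrow product IsPairProfile.trialState (LSSY2005_dysonProfile_holds,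
LSSY2005_jastrowBound_holds: energy ≤ 4πρ′a(1+12a/b)N on the torus of side L·M/(M+1)) multiplied by
the smooth partition-of-unity cut-off of exists_dirichlet_le_periodic (energy factor 1+4/M plus
4CNM/L²), whose flat-mode occupation is ≥ (1 − 6/M − N·∫(1−φ)/L³)²N by the pointwise bound of § Why
this line; choose η(θ,τ), M = ⌊√L⌋, Y small. Trivially true when a = 0 (s = 0). [deps:
ScatteringLengthFinite] [difficulty: M] -/
@[route_item "route-AtomisticToContinuum-BECNudgeWalk", crux]
def NudgedCondensation : Prop :=
  ∀ v : ℝ → ENNReal, Literature.MathematicalPhysics.QuantumManyBody.BoseGas.IsRepulsiveFiniteRange v → ∀ τ θ : ℝ, 0 < τ → 0 < θ → ∃ ρ₀ : ℝ, 0 < ρ₀ ∧ ∀ ρ : ℝ, 0 < ρ → ρ < ρ₀ → ∀ᶠ N : ℕ in Filter.atTop, let L : ℝ := Literature.MathematicalPhysics.QuantumManyBody.BoseGas.sideLength ρ N; let s : ℝ := θ * ρ * (Literature.MathematicalPhysics.QuantumManyBody.BoseGas.scatteringLength v).toReal; (⨅ Ψ : Literature.MathematicalPhysics.QuantumManyBody.BoseGas.TrialState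 N L, (Literature.MathematicalPhysics.QuantumManyBody.BoseGas.energy v Ψ + ENNReal.ofReal s * ((N : ENNReal) - Literature.MathematicalPhysics.QuantumManyBody.BoseGas.occupation N (Literature.MathematicalPhysics.QuantumManyBody.BoseGas.constantMode L) Ψ.ψ))) ≤ Literature.MathematicalPhysics.QuantumManyBody.BoseGas.groundStateEnergy v N L + ENNReal.ofReal (s * τ * N)

/-- item stmt-AtomisticToContinuum-9072 · crux · rank 6 · open · by planner
why it might fail: hard cores (v = ⊤ shells) disconnect the N-sphere configuration space; uniqueness then needs every non-dilute component (jammed/bound clusters) an N-uniform gap above E₀ — low-density connectivity is open in general; Perron–Frobenius for H_N is not in Mathlib.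
sources: ReedSimonIV1978, Kato1966, LSSY2005
[crux] (shared verbatim with BECPalmLandscape stmt-AtomisticToContinuum-3298; the uniqueness input
of the descent) for every repulsive finite-range v there is ρ₀ > 0 such that for 0 < ρ < ρ₀ and all
large N, for every η > 0 there is δ > 0 with: any two δ-near-minimisers Ψ, Φ of the Dirichlet energy
in the box of side (N/ρ)^{1/3} satisfy ∫|Ψ − cΦ|² ≤ η for some unit complex c (E₀ < ∞, compact
resolvent, unique positive ground state and spectral gap at fixed N). [difficulty: M] -/
@[route_item "route-AtomisticToContinuum-BECNudgeWalk", crux]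
def GroundStateRigidity : Prop :=
  ∀ v : ℝ → ENNReal, Literature.MathematicalPhysics.QuantumManyBody.BoseGas.IsRepulsiveFiniteRange v → ∃ ρ₀ : ℝ, 0 < ρ₀ ∧ ∀ ρ : ℝ, 0 < ρ → ρ < ρ₀ → ∀ᶠ N : ℕ in Filter.atTop, ∀ η : ℝ, 0 < η → ∃ δ : ENNReal, 0 < δ ∧ ∀ Ψ Φ : Literature.MathematicalPhysics.QuantumManyBody.BoseGas.TrialState N (Literature.MathematicalPhysics.QuantumManyBody.BoseGas.sideLength ρ N), Literature.MathematicalPhysics.QuantumManyBody.BoseGas.energy v Ψ ≤ Literature.MathematicalPhysics.QuantumManyBody.BoseGas.groundStateEnergy v N (Literature.MathematicalPhysics.QuantumManyBody.BoseGas.sideLength ρ N) + δ → Literature.MathematicalPhysics.QuantumManyBody.BoseGas.energy v Φ ≤ Literature.MathematicalPhysics.QuantumManyBody.BoseGas.groundStateEnergy v N (Literature.MathematicalPhysics.QuantumManyBody.BoseGas.sideLength ρ N) + δ → ∃ c : ℂ, ‖c‖ = 1 ∧ ∫⁻ X, (‖Ψ.ψ X - c * Φ.ψ X‖₊ : ENNReal)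 ^ 2 ≤ ENNReal.ofReal η

/-- item stmt-AtomisticToContinuum-12844 · support · rank 9 · closed · proved by Summit.AtomisticToContinuum.BoseEinsteinCondensation.Theorems.groundStateEnergyFinite_proof (prover) · by planner
sources: LSSY2005
[support] for repulsive finite-range v (range R₀) there is ρ₀ > 0 such that for ρ < ρ₀ and all large
N the Dirichlet ground-state energy in the box of side (N/ρ)^{1/3} is finite (N disjoint symmetric
C¹ bumps at mutual distance > R₀, interaction_eq_zero_of_lt_dist). [difficulty: provable-now] -/
@[route_item "route-AtomisticToContinuum-BECNudgeWalk", crux]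
def GroundStateEnergyFinite : Prop :=
  ∀ v : ℝ → ENNReal, Literature.MathematicalPhysics.QuantumManyBody.BoseGas.IsRepulsiveFiniteRange v → ∃ ρ₀ : ℝ, 0 < ρ₀ ∧ ∀ ρ : ℝ, 0 < ρ → ρ < ρ₀ → ∀ᶠ N : ℕ in Filter.atTop, Literature.MathematicalPhysics.QuantumManyBody.BoseGas.groundStateEnergy v N (Literature.MathematicalPhysics.QuantumManyBody.BoseGas.sideLength ρ N) ≠ ⊤

/-- `GroundStateEnergyFinite` holds: proved by `Summit.AtomisticToContinuum.BoseEinsteinCondensation.Theorems.groundStateEnergyFinite_proof`. -/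
theorem GroundStateEnergyFinite_holds : GroundStateEnergyFinite := _root_.Summit.AtomisticToContinuum.BoseEinsteinCondensation.Theorems.groundStateEnergyFinite_proof

/-- item stmt-AtomisticToContinuum-14363 · support · rank 9 · closed · proved by Summit.AtomisticToContinuum.BoseEinsteinCondensation.Cruxes.NudgeRemoval.Birth.walkGlue_proof @ b5325d8714b8 (prover) · by planner
sources: Kato1966, ReedSimonIV1978, Griffiths1966, LiebSeiringerYngvason2005
[support] (glue of the foreseen split NudgeRemoval ⇐ NudgedCondensation, NudgeGap,
CondensateVariance; kind glue, filed as support so the finite-N spectral bookkeeping can start)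
NudgedCondensation → NudgeGap → CondensateVariance → NudgeRemoval. Content, all at fixed (N, L): H_s
= H + s(N − n̂₀) on the Dirichlet box has compact resolvent and, for s > 0, a positivity-improving
semigroup (the reward's kernel L⁻³ > 0 teleports one particle anywhere, across hard-core components
too), so Ψ_s is unique, s ↦ R(s) is real-analytic and concave on (0,∞) with R′(s) = N − n₀(Ψ_s) and
−R″(s) = 2Σ_m |⟨m|n̂₀|Ψ_s⟩|²/(E_m − E_s) ≤ 2Var_(Ψ_s)(n̂₀)/Δ(s) (Kato II §6; Temple/Ky-Fan give the
variational form matching NudgeGap); bootstrap: given η, c, C take τ ≤ η/4 and θ := min(1,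
(c·min(τ,η/4)/4C)²); s* = inf{s : n₊(Ψ_s′) ≤ ηN/2 on [s, s₀]} is 0 because the rung bounds
n₊(Ψ_(s₀)) ≤ τN ≤ ηN/4 (concavity: s₀R′(s₀) ≤ R(s₀) − R(0)) and ∫ 2CN/(c√(ρa s)) ds ≤ (4C√θ/c)N ≤
min(τ, η/4)N; then R(s) ≤ R(0) + sR′(0⁺) ≤ E₀^D + s(R′(s₀⁻) + ∫χ) ≤ E₀^D + 2τsN. [difficulty: L] -/
@[route_item "route-AtomisticToContinuum-BECNudgeWalk"]
def WalkGlue : Prop :=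
  NudgedCondensation → NudgeGap → CondensateVariance → NudgeRemoval

/-- item stmt-AtomisticToContinuum-14364 · support · rank 9 · open · by planner
sources: LSSY2005, ReedSimonIV1978
[support] (from the walk output at one density to BEC at that density; pure finite-N bookkeeping +
L²-continuity of the occupation) for admissible v with 0 < a < ∞, ρ > 0, 0 < τ ≤ 1/8: if eventually
E₀^D(N,L) < ⊤, eventually [∃ s₀ > 0 ∀ s ∈ (0,s₀]: R(s) ≤ E₀^D + 2τsN], and eventually [the
GroundStateRigidity body at N], then HasGroundStateBEC v ρ (with c = 1/2). Proof: fix large N, take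
η = 1/400 and δ from rigidity, then s ≤ s₀ with 3τsN < δ; iInf_lt_iff gives Ψ with F_s(Ψ) < E₀^D +
3τsN, hence energy(Ψ) ≤ E₀^D + δ and n₀(Ψ) > (1−3τ)N (cancel the finite energy in ℝ≥0∞); every
δ-near-minimiser Φ is η-close to cΨ, and √n₀ is √N-Lipschitz in L² (n₀(Ψ) = N‖TΨ‖², T = contraction
against φ₀), so n₀(Φ) ≥ (√(5/8) − 1/20)²N ≥ N/2; occupation_le_maxOccupation (constantMode
measurable, normalised by volume_cell) and le_condensateNumber finish. [difficulty: M] -/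
@[route_item "route-AtomisticToContinuum-BECNudgeWalk", crux]
def WalkToBEC : Prop :=
  ∀ v : ℝ → ENNReal, Literature.MathematicalPhysics.QuantumManyBody.BoseGas.IsRepulsiveFiniteRange v → 0 < Literature.MathematicalPhysics.QuantumManyBody.BoseGas.scatteringLength v → Literature.MathematicalPhysics.QuantumManyBody.BoseGas.scatteringLength v ≠ ⊤ → ∀ ρ : ℝ, 0 < ρ → ∀ τ : ℝ, 0 < τ → τ ≤ 1 / 8 → (∀ᶠ N : ℕ in Filter.atTop, Literature.MathematicalPhysics.QuantumManyBody.BoseGas.groundStateEnergy v N (Literature.MathematicalPhysics.QuantumManyBody.BoseGas.sideLength ρ N) ≠ ⊤) → (∀ᶠ N : ℕ in Filter.atTop, ∃ s₀ : ℝ, 0 < s₀ ∧ ∀ s : ℝ, 0 < s → s ≤ s₀ → (⨅ Ψ : Literature.MathematicalPhysics.QuantumManyBody.BoseGas.TrialState N (Literature.MathematicalPhysics.QuantumManyBody.BoseGas.sideLength ρ N), (Literature.MathematicalPhysics.QuantumManyBody.BoseGas.energy v Ψ + ENNReal.ofReal s * ((N : ENNReal) - Literature.MathematicalPhysics.QuantumManyBody.BoseGas.occupation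 N (Literature.MathematicalPhysics.QuantumManyBody.BoseGas.constantMode (Literature.MathematicalPhysics.QuantumManyBody.BoseGas.sideLength ρ N)) Ψ.ψ))) ≤ Literature.MathematicalPhysics.QuantumManyBody.BoseGas.groundStateEnergy v N (Literature.MathematicalPhysics.QuantumManyBody.BoseGas.sideLength ρ N) + ENNReal.ofReal (2 * τ * s * N)) → (∀ᶠ N : ℕ in Filter.atTop, ∀ η : ℝ, 0 < η → ∃ δ : ENNReal, 0 < δ ∧ ∀ Ψ Φ : Literature.MathematicalPhysics.QuantumManyBody.BoseGas.TrialState N (Literature.MathematicalPhysics.QuantumManyBody.BoseGas.sideLength ρ N), Literature.MathematicalPhysics.QuantumManyBody.BoseGas.energy v Ψ ≤ Literature.MathematicalPhysics.QuantumManyBody.BoseGas.groundStateEnergy v N (Literature.MathematicalPhysics.QuantumManyBody.BoseGas.sideLength ρ N) + δ → Literature.MathematicalPhysics.QuantumManyBody.BoseGas.energy v Φ ≤ Literature.MathematicalPhysics.QuantumManyBody.BoseGas.groundStateEnergy v N (Literature.MathematicalPhysics.QuantumManyBody.BoseGas.sideLength ρ N) + δ → ∃ c : ℂ, ‖c‖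 = 1 ∧ ∫⁻ X, (‖Ψ.ψ X - c * Φ.ψ X‖₊ : ENNReal) ^ 2 ≤ ENNReal.ofReal η) → Literature.MathematicalPhysics.QuantumManyBody.BoseGas.HasGroundStateBEC v ρ

/-- item stmt-AtomisticToContinuum-14365 · support · rank 9 · open · by planner
sources: LSSY2005, Fournais2020
[support] (the degenerate case a = 0, where s₀ = 0 and the flat mode is the WRONG mode: the free
Dirichlet ground state is the sine product, flat-mode fraction (8/π²)³ ≈ 0.53) for admissible v with
scatteringLength v = 0 and every ρ > 0, HasGroundStateBEC v ρ (c = 1/2). Proof: v(|x|) = 0 a.e.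
(LSSY2005_zeroScatteringLength_holds, proved), so energy = kinetic; odd reflection to the torus of
side 2L and Parseval there (PeriodicBoseGasFourier) give the Dirichlet cube bounds Σ_i∫|∇_iΨ|² ≥
3π²N/L² + (3π²/L²)(N − n_sine(Ψ)) for C¹ Ψ vanishing off Λ^N and E₀^D ≤ 3π²N/L²(1+ε) (mollified sine
product); δ := 3π²N/(2L²) gives n_sine ≥ N/2 for every δ-near-minimiser, and le_condensateNumber.
[difficulty: M] -/
@[route_item "route-AtomisticToContinuum-BECNudgeWalk", crux]
def FreeDirichletBEC : Prop :=
  ∀ v : ℝ → ENNReal, Literature.MathematicalPhysics.QuantumManyBody.BoseGas.IsRepulsiveFiniteRange v → Literature.MathematicalPhysics.QuantumManyBody.BoseGas.scatteringLength v = 0 → ∀ ρ : ℝ, 0 < ρ → Literature.MathematicalPhysics.QuantumManyBody.BoseGas.HasGroundStateBEC v ρ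

/-- item stmt-AtomisticToContinuum-9006 · support · rank 9 · closed · proved by Summit.AtomisticToContinuum.BoseEinsteinCondensation.Theorems.scatteringLengthFinite_proof @ 2b49af526fb0 (prover) · by planner
sources: LSSY2005
[support] (shared verbatim with route EqualScatteringTransfer, stmt-AtomisticToContinuum-0851)
finite range ⇒ scatteringLength v ≠ ⊤ (a ≤ R₀ + ε by the C¹ trial φ = 0 on B_{R₀}, = 1 off B_{R₀+ε};
hard cores included since ⊤·0 = 0). Discharges the `≠ ⊤` hypothesis of the cruxes in the glue.
[difficulty: provable-now] -/
@[route_item "route-AtomisticToContinuum-BECNudgeWalk", crux]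
def ScatteringLengthFinite : Prop :=
  ∀ v : ℝ → ENNReal, Literature.MathematicalPhysics.QuantumManyBody.BoseGas.IsRepulsiveFiniteRange v → Literature.MathematicalPhysics.QuantumManyBody.BoseGas.scatteringLength v ≠ ⊤

/-- `ScatteringLengthFinite` holds: proved by `Summit.AtomisticToContinuum.BoseEinsteinCondensation.Theorems.scatteringLengthFinite_proof` @ 2b49af526fb0. -/
theorem ScatteringLengthFinite_holds : ScatteringLengthFinite := _root_.Summit.AtomisticToContinuum.BoseEinsteinCondensation.Theorems.scatteringLengthFinite_proof

/-- item stmt-AtomisticToContinuum-14366 · assembly · rank 1 · open · by planner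
sources: LSSY2005, LauwersVerbeureZagrebnov2003
[assembly] NudgeGap → CondensateVariance → NudgeRemoval → NudgedCondensation → GroundStateRigidity →
WalkGlue → WalkToBEC → FreeDirichletBEC → GroundStateEnergyFinite → ScatteringLengthFinite →
BoseEinsteinCondensation (proof = the `closes` term of this route, pure logic). -/
@[route_item "route-AtomisticToContinuum-BECNudgeWalk"]
def Assembly : Prop :=
  NudgeGap → CondensateVariance → NudgeRemoval → NudgedCondensation → GroundStateRigidity → WalkGlue → WalkToBEC → FreeDirichletBEC → GroundStateEnergyFinite → ScatteringLengthFinite → BoseEinsteinCondensation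

/-! D-0027 §2.1 — DECIDING THEOREM (planner-authored via `route open/edit --closes-file`; by planner-rrepair-AtomisticToContinuum-BECNudgeW-914e7c39-0 2026-08-15T19:52:57Z):
its hypotheses are this route's items and its conclusion the sub-problem Statement (glue_lint), and it elaborates with this file. -/

@[closes "route-AtomisticToContinuum-BECNudgeWalk"] theorem closes (h_NudgeRemoval : NudgeRemoval) (h_NudgedCondensation : NudgedCondensation)
    (h_GroundStateRigidity : GroundStateRigidity) (h_WalkToBEC : WalkToBEC)
    (h_FreeDirichletBEC : FreeDirichletBEC) (h_GroundStateEnergyFinite : GroundStateEnergyFinite)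
    (h_ScatteringLengthFinite : ScatteringLengthFinite) :
    BoseEinsteinCondensation := by
  -- Load-bearing items: the thesis X = NudgedCondensation ∧ NudgeRemoval plus rigidity, the free case
  -- and the two finiteness supports. The MECHANISM for NudgeRemoval is the item
  -- `WalkGlue : NudgedCondensation → NudgeGap → CondensateVariance → NudgeRemoval`: proofs of the cruxes
  -- NudgeGap and CondensateVariance (with WalkGlue and the rung) give `NudgeRemoval` by one application,
  -- and a direct proof of NudgeRemoval decides the route equally — neither path is privileged here.
  -- `Assembly` (all ten items → Statement) follows from this term by weakening.
  intro v hv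
  rcases eq_or_ne (Literature.MathematicalPhysics.QuantumManyBody.BoseGas.scatteringLength v) 0 with ha0 | ha0
  · -- free gas: condensation in the sine mode, every density
    exact ⟨1, one_pos, fun ρ hρ _ => h_FreeDirichletBEC v hv ha0 ρ hρ⟩
  · have hapos : 0 < Literature.MathematicalPhysics.QuantumManyBody.BoseGas.scatteringLength v :=
      pos_iff_ne_zero.mpr ha0
    have hatop := h_ScatteringLengthFinite v hv
    obtain ⟨θ, ρ₁, hθ, -, hρ₁, Hrem⟩ := h_NudgeRemoval v hv (1 / 8) (by norm_num)
    obtain ⟨ρ₂, hρ₂, Hrung⟩ := h_NudgedCondensation v hv (1 / 8) θ (by norm_num) hθ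
    obtain ⟨ρ₃, hρ₃, Hfin⟩ := h_GroundStateEnergyFinite v hv
    obtain ⟨ρ₄, hρ₄, Hrig⟩ := h_GroundStateRigidity v hv
    refine ⟨min ρ₁ (min ρ₂ (min ρ₃ ρ₄)), by positivity, fun ρ hρ hρlt => ?_⟩
    have h1 : ρ < ρ₁ := lt_of_lt_of_le hρlt (min_le_left _ _)
    have h2 : ρ < ρ₂ := lt_of_lt_of_le hρlt ((min_le_right _ _).trans (min_le_left _ _))
    have h3 : ρ < ρ₃ := lt_of_lt_of_le hρlt
      ((min_le_right _ _).trans ((min_le_right _ _).trans (min_le_left _ _)))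
    have h4 : ρ < ρ₄ := lt_of_lt_of_le hρlt
      ((min_le_right _ _).trans ((min_le_right _ _).trans (min_le_right _ _)))
    have ha : 0 < (Literature.MathematicalPhysics.QuantumManyBody.BoseGas.scatteringLength v).toReal :=
      ENNReal.toReal_pos ha0 hatop
    -- rung at s₀ = θρa feeds the removal; WalkToBEC (rigidity + finiteness) concludes at density ρ
    refine h_WalkToBEC v hv hapos hatop ρ hρ (1 / 8) (by norm_num) le_rfl (Hfin ρ hρ h3) ?_ (Hrig ρ hρ h4)
    filter_upwards [Hrem ρ hρ h1, Hrung ρ hρ h2] with N hN1 hN2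
    exact ⟨θ * ρ * (Literature.MathematicalPhysics.QuantumManyBody.BoseGas.scatteringLength v).toReal,
      by positivity, fun s hs hss => hN1 hN2 s hs hss⟩

end Summit.AtomisticToContinuum.BoseEinsteinCondensation.Theses.BECNudgeWalk
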